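import Summits.QuantumFields.BalabanUV.Beta.CombRemainderParityAll

/-!
# `BalabanUV.Gaps.D1BinderEnds` — cell `pub-balaban-gaps` (YM blitz Y1), track G1, seat g1-p1: **THE BINDER (D1) OF [B12] THEOREM 2 CUT AT THE JET LEVEL
# INTO ITS `O(1)`-TOLERANT TELESCOPING CLAUSE AND ITS SCHEME-FREE ANALYTIC RESIDUE (the one-shot one-loop law); two out of three; the link to `D1Rep`
# under the two PRINTED [B5] statements; and the ENDs AT THE LITERAL OF RECORD with every numeral ∕ window binder instantiated**

HONEST FRAMING (page 1, cell contract).  WHAT THIS IS: a GAP CERTIFICATE — [folklore] triangle-inequality ∕ instantiation theorems composed BY NAME over the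
β sub-cell's root of record ROOT M‴ `Summit.QuantumFields.BalabanUV.Beta.CombRemainderParityAll.d1Drift_JsB12CombShSym_an1TablesS2_pinned_of_locks_D1Tel_D1Rep`
(p325680; BINDER-OWNERS row D1, owner lineage beta-an2) and the β-lead's free-bubble drift `Beta.ScalewiseVectorSeam.oneShotSide_drift`.  WHAT THIS IS NOT: not a
proof of (D1); nothing of Bałaban's papers is asserted or discharged; [B12] Theorem 2 (T. Bałaban, CMP 109 (1987), p. 259) is printed WITHOUT proof («A proof
of this theorem, based on perturbative calculations, will be given in a separate paper») and proved nowhere in print ([B16], CMP 122 (1989), p. 355 «has not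
been published yet»); NOT `BetaPertH`, NOT the continuum limit, NOT Clay.  HONEST DEPENDENCY (verbatim): continuum YM on T⁴ ⇐ BetaPertH ∧ nine spine
estimates (0/9 proved); BetaPertH ⇐ (D1) ∧ (D4) ∧ CAP+tail; G-an2-4 gates asym, D1 and NE2/3/4.

THE BINDER.  (D1) = `Beta.OneStepKernelFamily.D1Drift Lc Js N μ ν := ∃ A, ∀ k, |Σ_{j<k} secondMoment (TbalOf Lc Js j) μ ν − k · stepBal N Lc| ≤ A`
(`stepBal N L = (11N²/12π²)·log L`): the (1.22)-coefficients `β⁰_j` of the typed step-`j` systems drift with the asymptotic-freedom slope up to a bounded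
cumulative defect.  THE LITERAL OF RECORD of row D1 (gen 41) is the chart-(III′) step-jet family `JsB12CombShSym hLc N (symTablesAn1S2 3 Lc cΛ) cΛ cB` at an1's
unit locks `cΛ·Lc⁴ = 2`, `cB = −Lc¹²/4`.

THE CUT (hypotheses written INLINE here; NAMED as the predicates `ReadoutBdd` ∕ `OneShotLaw` ∕ `Residue` in the companion statement file `Gaps/D1Residue.lean`;
jet-level, `O(1)`-tolerant form of the abstract (T1)/(T2) reading of `Beta.OneShotTelescope` (strat-b12) and the `D1Rep`-free twin of `Beta.RowD1TelescopingBounded` §1 (an2)):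
* (RB) BOUNDED CUMULATIVE READ-OUT DEFECT `∃ U′, ∀ m ≥ 1, |Σ_{j<m} β⁰_j(Js) − secondMoment (TshotOf Lc Jc m) μ ν| ≤ U′` — the STEP coefficients' partial sums track
  the ONE-SHOT coefficient of the `m`-step composite (block `Lc^m`) system with jets `Jc`; implied with `U′ = 0` by exact telescoping `D1Tel` + the (T0)/(T1)
  symmetries of the step family (`HidentScalewise.flowSum_eq_oneShotReadout`) — KKT-composition algebra of OUR typed objects (road FP).
* (OSL) THE ONE-SHOT ONE-LOOP LAW `∃ U, ∀ m ≥ 1, |secondMoment (TshotOf Lc Jc m) μ ν − m · stepBal N Lc| ≤ U`, i.e. `= (11N²/12π²)·log (Lc^m) + O(1)` — SCHEME-FREE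
  (no window constant, no stencil labels, no free-bubble table, no printed input); for Bałaban's jets the located UNPRINTED one-loop computation behind
  [B12] Theorem 2 (road BF-x = EXIT-A attacks it through `D1Rep`).
THEOREMS (all [folklore]).  §1 among {(D1), (RB), (OSL)} ANY TWO GIVE THE THIRD (pure triangle inequality: NO printed input, NO symmetry, NO window) — so for every
telescoping partner `Jc`, (D1) ⟺ (OSL).  §2 under the two PRINTED [B5] statements BY NAME (`h12 : B5.Prop12Printed …`, `h126 : B5.Kernel126_127Printed …` — cited
upstream, displayed, NOT proved), labels, window data, `μ ≠ ν`, `N ≠ 0`, `2 ≤ Lc`: (OSL) ⟺ `D1Rep`.  §3 AT THE LITERAL OF RECORD: ROOT M‴ with the locks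
(`cΛ := 2/Lc⁴`, `cB := −Lc¹²/4`) AND the window (`M := id`, `cc := 1`) INSTANTIATED (`d1Drift_record_of_D1Tel_D1Rep` — displays exactly `D1Tel`, `D1Rep`, the two
printed [B5] statements, labels, `μ ≠ ν`, `Nc ≠ 0`, `Odd Lc`, `2 ≤ Lc`, `2 ≤ N`); the SCHEME-FREE END (`d1Drift_record_of_readoutBdd_oneShotLaw`: (RB) ∧ (OSL) ⟹ (D1),
nothing else displayed) with its EXACTNESS (`d1Drift_record_iff_oneShotLaw_of_readoutBdd`); the MIXED END (`d1Drift_record_of_readoutBdd_D1Rep`).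

CENSUS WORDS for `HOME/BALABAN-GAPS.md` row (D1) (evidence = these decls; repair census `HOME/g1/RESIDUE.md`): (D1) at the literal of record ⟺ (RB) ∧ (OSL) for a
composite jet partner; (RB) = WORK-bound (composition algebra; road FP, d1-p3); (OSL) = the exact missing lemma — the one-loop asymptotic-freedom computation
for the one-shot block transformation, NOT IN PRINT (road BF-x, d1-p2, reduces it to per-word table bounds + printed [B5] Prop 1.2 ∕ (1.126)–(1.127)).

ABSOLUTE RULE (cell charter, verbatim): «No internally-minted statement may enter as a cited fact. Every hypothesis is either kernel-proved in this package or a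
verbatim quotation of a PUBLISHED theorem with page reference.»  Nothing below is cited; no `def`, no `Prop` minted; no `sorry`; axioms ⊆ the standard trio.
Provenance: cell pub-balaban-gaps, seat g1-p1, 2026-08-22; imports ROOT M‴ only (everything else transitively); no existing file touched.
-/

noncomputable section

open Finset
open scoped BigOperators
open Literature.MathematicalPhysics.QuantumFieldTheory
open Literature.MathematicalPhysics.QuantumFieldTheory.Balaban1983to89
open Literature.MathematicalPhysics.QuantumFieldTheory.Balaban1983to89.Beta
open OneStepResolventKernel (JetData)
open OneStepKernelFamily (TbalOf TshotOf D1Tel D1Rep D1Drift)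
open B12Beta (secondMoment)
open ScalewiseVectorSeam (oneShotSide oneShotSide_drift)
open VectorTailsLoc (fam kfam)
open VectorLegVolumeAdapter (MvE)
open Summit.QuantumFields.BalabanUV.Beta.CombChartJointEnd (JsB12CombShSym)
open Summit.QuantumFields.BalabanUV.Beta.SymSecondOrderTablesAn1 (symTablesAn1S2)
open Summit.QuantumFields.BalabanUV.Beta.CombRemainderParityAll (d1Drift_JsB12CombShSym_an1TablesS2_pinned_of_locks_D1Tel_D1Rep)

namespace Summit.QuantumFields.BalabanUV.Gaps.D1BinderEnds

variable {Lc : ℕ} [NeZero Lc] {L : Type*}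

/-! ## §1 Two out of three among (D1), (RB) bounded read-out defect, (OSL) one-shot law — generic jet data, triangle inequality only -/

/-- [folklore] A bound `|x| ≤ U` at one instance forces `0 ≤ U`. -/
private theorem nonneg_of_abs_le {x U : ℝ} (h : |x| ≤ U) : 0 ≤ U := (abs_nonneg x).trans h

/-- [folklore] **(RB) ∧ (OSL) ⟹ (D1)** for generic step jets `Js` and composite jets `Jc` (NO printed input, NO symmetry, NO window). -/
theorem d1Drift_of_readoutBdd_oneShotLaw (Js : ℕ → JetData 3 Lc) (Jc : ∀ m : ℕ, JetData 3 (Lc ^ m)) {N : ℝ} {μ ν : Fin 4}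
    (hbdd : ∃ U' : ℝ, ∀ m : ℕ, 1 ≤ m → |∑ j ∈ range m, secondMoment (TbalOf Lc Js j) μ ν - secondMoment (TshotOf Lc Jc m) μ ν| ≤ U')
    (hlaw : ∃ U : ℝ, ∀ m : ℕ, 1 ≤ m → |secondMoment (TshotOf Lc Jc m) μ ν - B12Normalization.stepBal N Lc * m| ≤ U) :
    D1Drift Lc Js N μ ν := by
  obtain ⟨U', hU'⟩ := hbdd
  obtain ⟨U, hU⟩ := hlaw
  refine ⟨U' + U, fun n => ?_⟩
  rcases Nat.eq_zero_or_pos n with rfl | hn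
  · simp only [Finset.range_zero, Finset.sum_empty, Nat.cast_zero, mul_zero, sub_zero, abs_zero]
    exact add_nonneg (nonneg_of_abs_le (hU' 1 le_rfl)) (nonneg_of_abs_le (hU 1 le_rfl))
  · have e : ∑ j ∈ range n, secondMoment (TbalOf Lc Js j) μ ν - B12Normalization.stepBal N Lc * n
        = (∑ j ∈ range n, secondMoment (TbalOf Lc Js j) μ ν - secondMoment (TshotOf Lc Jc n) μ ν)
          + (secondMoment (TshotOf Lc Jc n) μ ν - B12Normalization.stepBal N Lc * n) := by ring
    rw [e]
    exact (abs_add_le _ _).trans (add_le_add (hU' n hn) (hU n hn))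

/-- [folklore] **(D1) ∧ (RB) ⟹ (OSL)** — the direction that makes the one-shot law NECESSARY given a telescoping partner. -/
theorem oneShotLaw_of_d1Drift_readoutBdd (Js : ℕ → JetData 3 Lc) (Jc : ∀ m : ℕ, JetData 3 (Lc ^ m)) {N : ℝ} {μ ν : Fin 4}
    (hD : D1Drift Lc Js N μ ν)
    (hbdd : ∃ U' : ℝ, ∀ m : ℕ, 1 ≤ m → |∑ j ∈ range m, secondMoment (TbalOf Lc Js j) μ ν - secondMoment (TshotOf Lc Jc m) μ ν| ≤ U') :
    ∃ U : ℝ, ∀ m : ℕ, 1 ≤ m → |secondMoment (TshotOf Lc Jc m) μ ν - B12Normalization.stepBal N Lc * m| ≤ U := by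
  obtain ⟨A, hA⟩ := hD
  obtain ⟨U', hU'⟩ := hbdd
  refine ⟨A + U', fun n hn => ?_⟩
  have e : secondMoment (TshotOf Lc Jc n) μ ν - B12Normalization.stepBal N Lc * n
      = (∑ j ∈ range n, secondMoment (TbalOf Lc Js j) μ ν - B12Normalization.stepBal N Lc * n)
        - (∑ j ∈ range n, secondMoment (TbalOf Lc Js j) μ ν - secondMoment (TshotOf Lc Jc n) μ ν) := by ring
  rw [e]
  exact (abs_sub _ _).trans (add_le_add (hA n) (hU' n hn))

/-- [folklore] **(D1) ∧ (OSL) ⟹ (RB)** — the third direction. -/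
theorem readoutBdd_of_d1Drift_oneShotLaw (Js : ℕ → JetData 3 Lc) (Jc : ∀ m : ℕ, JetData 3 (Lc ^ m)) {N : ℝ} {μ ν : Fin 4}
    (hD : D1Drift Lc Js N μ ν)
    (hlaw : ∃ U : ℝ, ∀ m : ℕ, 1 ≤ m → |secondMoment (TshotOf Lc Jc m) μ ν - B12Normalization.stepBal N Lc * m| ≤ U) :
    ∃ U' : ℝ, ∀ m : ℕ, 1 ≤ m → |∑ j ∈ range m, secondMoment (TbalOf Lc Js j) μ ν - secondMoment (TshotOf Lc Jc m) μ ν| ≤ U' := by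
  obtain ⟨A, hA⟩ := hD
  obtain ⟨U, hU⟩ := hlaw
  refine ⟨A + U, fun n hn => ?_⟩
  have e : ∑ j ∈ range n, secondMoment (TbalOf Lc Js j) μ ν - secondMoment (TshotOf Lc Jc n) μ ν
      = (∑ j ∈ range n, secondMoment (TbalOf Lc Js j) μ ν - B12Normalization.stepBal N Lc * n)
        - (secondMoment (TshotOf Lc Jc n) μ ν - B12Normalization.stepBal N Lc * n) := by ring
  rw [e]
  exact (abs_sub _ _).trans (add_le_add (hA n) (hU n hn))

/-- [folklore] **EXACTNESS**: given a telescoping partner `Jc` ((RB)), (D1) ⟺ (OSL). -/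
theorem d1Drift_iff_oneShotLaw_of_readoutBdd (Js : ℕ → JetData 3 Lc) (Jc : ∀ m : ℕ, JetData 3 (Lc ^ m)) {N : ℝ} {μ ν : Fin 4}
    (hbdd : ∃ U' : ℝ, ∀ m : ℕ, 1 ≤ m → |∑ j ∈ range m, secondMoment (TbalOf Lc Js j) μ ν - secondMoment (TshotOf Lc Jc m) μ ν| ≤ U') :
    D1Drift Lc Js N μ ν ↔
      ∃ U : ℝ, ∀ m : ℕ, 1 ≤ m → |secondMoment (TshotOf Lc Jc m) μ ν - B12Normalization.stepBal N Lc * m| ≤ U :=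
  ⟨fun hD => oneShotLaw_of_d1Drift_readoutBdd Js Jc hD hbdd, fun hlaw => d1Drift_of_readoutBdd_oneShotLaw Js Jc hbdd hlaw⟩

/-- [folklore] The slope along the powers: `stepBal N (Lc^m) = m · stepBal N Lc` (`Real.log_pow`). -/
theorem stepBal_pow (N : ℝ) (Lc m : ℕ) :
    B12Normalization.stepBal N ((Lc : ℝ) ^ m) = B12Normalization.stepBal N Lc * m := by
  rw [B12Normalization.stepBal_eq, B12Normalization.stepBal_eq, Real.log_pow]
  ring

/-- [folklore] (OSL) ⟺ its `log (Lc^m)` form `|secondMoment (TshotOf Lc Jc m) μ ν − (11N²/12π²)·log (Lc^m)| ≤ U`. -/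
theorem oneShotLaw_iff_log_form (Jc : ∀ m : ℕ, JetData 3 (Lc ^ m)) (N : ℝ) (μ ν : Fin 4) :
    (∃ U : ℝ, ∀ m : ℕ, 1 ≤ m → |secondMoment (TshotOf Lc Jc m) μ ν - B12Normalization.stepBal N Lc * m| ≤ U) ↔
      ∃ U : ℝ, ∀ m : ℕ, 1 ≤ m → |secondMoment (TshotOf Lc Jc m) μ ν - B12Normalization.stepBal N ((Lc : ℝ) ^ m)| ≤ U := by
  simp only [stepBal_pow]

/-! ## §2 Under the two PRINTED [B5] statements BY NAME: (OSL) ⟺ `D1Rep` -/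

/-- [folklore] **`D1Rep` ∧ printed [B5] inputs ⟹ (OSL)**: the free bubble `oneShotSide` drifts with slope `stepBal` (`ScalewiseVectorSeam.oneShotSide_drift`; its
inputs — the two PRINTED [B5] statements `h12`/`h126` BY NAME (cited upstream, displayed, NOT proved), labels `SL`/`k`, window data, `μ ≠ ν`, `N ≠ 0`, `2 ≤ Lc` —
are passed through verbatim). -/
theorem oneShotLaw_of_d1Rep (a : ℝ) (ha : 0 < a)
    (h12 : B5.Prop12Printed (fam (fun i : ℕ+ × ℕ => ((i.1 : ℕ+) : ℕ)) (fun i => i.1.pos) MvE a ha))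
    (h126 : B5.Kernel126_127Printed (kfam (fun i : ℕ+ × ℕ => ((i.1 : ℕ+) : ℕ)) MvE))
    {SL : Finset L} (hSL : SL.Nonempty) (k : L → Fin 4) {μ ν : Fin 4} (hμν : μ ≠ ν) {N : ℝ} (hN : N ≠ 0) (hL : 2 ≤ Lc)
    {cc : ℝ} {M : ℕ → ℕ} (hc : 1 ≤ cc) (hM : ∀ L : ℕ, 2 ≤ L → 1 ≤ M L ∧ (L : ℝ) ≤ cc * M L) (hML : ∀ L : ℕ, 2 ≤ L → M L ≤ L)
    (Jc : ∀ m : ℕ, JetData 3 (Lc ^ m)) (hrep : D1Rep Lc Jc N μ ν a SL k) :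
    ∃ U : ℝ, ∀ m : ℕ, 1 ≤ m → |secondMoment (TshotOf Lc Jc m) μ ν - B12Normalization.stepBal N Lc * m| ≤ U := by
  obtain ⟨U, hU⟩ := hrep
  obtain ⟨A, hA⟩ := oneShotSide_drift a ha h12 h126 hSL k hμν hN hL hc hM hML
  refine ⟨U + A + |oneShotSide SL μ ν N a k (Lc ^ 0)|, fun n hn => ?_⟩
  have e : secondMoment (TshotOf Lc Jc n) μ ν - B12Normalization.stepBal N Lc * n
      = (secondMoment (TshotOf Lc Jc n) μ ν - oneShotSide SL μ ν N a k (Lc ^ n))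
        + (oneShotSide SL μ ν N a k (Lc ^ n) - oneShotSide SL μ ν N a k (Lc ^ 0) - B12Normalization.stepBal N Lc * n)
        + oneShotSide SL μ ν N a k (Lc ^ 0) := by ring
  rw [e]
  exact (abs_add_le _ _).trans (add_le_add ((abs_add_le _ _).trans (add_le_add (hU n hn) (hA n))) le_rfl)

/-- [folklore] **(OSL) ∧ printed [B5] inputs ⟹ `D1Rep`** (the converse bookkeeping, same standing data). -/
theorem d1Rep_of_oneShotLaw (a : ℝ) (ha : 0 < a)
    (h12 : B5.Prop12Printed (fam (fun i : ℕ+ × ℕ => ((i.1 : ℕ+) : ℕ)) (fun i => i.1.pos) MvE a ha))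
    (h126 : B5.Kernel126_127Printed (kfam (fun i : ℕ+ × ℕ => ((i.1 : ℕ+) : ℕ)) MvE))
    {SL : Finset L} (hSL : SL.Nonempty) (k : L → Fin 4) {μ ν : Fin 4} (hμν : μ ≠ ν) {N : ℝ} (hN : N ≠ 0) (hL : 2 ≤ Lc)
    {cc : ℝ} {M : ℕ → ℕ} (hc : 1 ≤ cc) (hM : ∀ L : ℕ, 2 ≤ L → 1 ≤ M L ∧ (L : ℝ) ≤ cc * M L) (hML : ∀ L : ℕ, 2 ≤ L → M L ≤ L)
    (Jc : ∀ m : ℕ, JetData 3 (Lc ^ m))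
    (hlaw : ∃ U : ℝ, ∀ m : ℕ, 1 ≤ m → |secondMoment (TshotOf Lc Jc m) μ ν - B12Normalization.stepBal N Lc * m| ≤ U) :
    D1Rep Lc Jc N μ ν a SL k := by
  obtain ⟨U, hU⟩ := hlaw
  obtain ⟨A, hA⟩ := oneShotSide_drift a ha h12 h126 hSL k hμν hN hL hc hM hML
  refine ⟨U + A + |oneShotSide SL μ ν N a k (Lc ^ 0)|, fun n hn => ?_⟩
  have e : secondMoment (TshotOf Lc Jc n) μ ν - oneShotSide SL μ ν N a k (Lc ^ n)
      = (secondMoment (TshotOf Lc Jc n) μ ν - B12Normalization.stepBal N Lc * n)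
        - (oneShotSide SL μ ν N a k (Lc ^ n) - oneShotSide SL μ ν N a k (Lc ^ 0) - B12Normalization.stepBal N Lc * n)
        - oneShotSide SL μ ν N a k (Lc ^ 0) := by ring
  rw [e]
  exact (abs_sub _ _).trans (add_le_add ((abs_sub _ _).trans (add_le_add (hU n hn) (hA n))) le_rfl)

/-- [folklore] **Under the printed [B5] inputs (and labels, window, `μ ≠ ν`, `N ≠ 0`, `2 ≤ Lc`): (OSL) ⟺ `D1Rep`.** -/
theorem oneShotLaw_iff_d1Rep (a : ℝ) (ha : 0 < a)
    (h12 : B5.Prop12Printed (fam (fun i : ℕ+ × ℕ => ((i.1 : ℕ+) : ℕ)) (fun i => i.1.pos) MvE a ha))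
    (h126 : B5.Kernel126_127Printed (kfam (fun i : ℕ+ × ℕ => ((i.1 : ℕ+) : ℕ)) MvE))
    {SL : Finset L} (hSL : SL.Nonempty) (k : L → Fin 4) {μ ν : Fin 4} (hμν : μ ≠ ν) {N : ℝ} (hN : N ≠ 0) (hL : 2 ≤ Lc)
    {cc : ℝ} {M : ℕ → ℕ} (hc : 1 ≤ cc) (hM : ∀ L : ℕ, 2 ≤ L → 1 ≤ M L ∧ (L : ℝ) ≤ cc * M L) (hML : ∀ L : ℕ, 2 ≤ L → M L ≤ L)
    (Jc : ∀ m : ℕ, JetData 3 (Lc ^ m)) :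
    (∃ U : ℝ, ∀ m : ℕ, 1 ≤ m → |secondMoment (TshotOf Lc Jc m) μ ν - B12Normalization.stepBal N Lc * m| ≤ U) ↔ D1Rep Lc Jc N μ ν a SL k :=
  ⟨d1Rep_of_oneShotLaw a ha h12 h126 hSL k hμν hN hL hc hM hML Jc, oneShotLaw_of_d1Rep a ha h12 h126 hSL k hμν hN hL hc hM hML Jc⟩

/-! ## §3 At the literal of record: the ENDs with an1's locks and the free-bubble window instantiated -/

omit [NeZero Lc] in
/-- [folklore] The first lock at its value: `(2/Lc⁴)·Lc⁴ = 2` for `2 ≤ Lc`. -/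
theorem lock_mul_pow (hL2 : 2 ≤ Lc) : 2 / (Lc : ℝ) ^ 4 * (Lc : ℝ) ^ 4 = 2 := by
  have hLc : (Lc : ℝ) ≠ 0 := by
    have : (0 : ℝ) < Lc := by exact_mod_cast (by omega : 0 < Lc)
    exact this.ne'
  field_simp

/-- [folklore] The trivial window `M := id`, `cc := 1` meets the window data of the free-bubble drift. -/
theorem window_id : ∀ Lw : ℕ, 2 ≤ Lw → 1 ≤ (fun n : ℕ => n) Lw ∧ (Lw : ℝ) ≤ (1 : ℝ) * ((fun n : ℕ => n) Lw : ℕ) := by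
  intro Lw hLw
  refine ⟨?_, by simp⟩
  show 1 ≤ Lw
  omega

/-- [folklore] The trivial window is not wider than the block: `M L ≤ L`. -/
theorem window_id_le : ∀ Lw : ℕ, 2 ≤ Lw → (fun n : ℕ => n) Lw ≤ Lw := fun _ _ => le_rfl

/-- [folklore] **ROOT M‴ WITH THE LOCKS AND THE WINDOW INSTANTIATED.**  At the step jets of record
`JsB12CombShSym hLc N (symTablesAn1S2 3 Lc (2/Lc⁴)) (2/Lc⁴) (−Lc¹²/4)`: exact telescoping `D1Tel` onto composite jets `Jc` (road FP), the representation
binder `D1Rep` for those jets (road BF-x), the two PRINTED [B5] statements BY NAME (`h12`, `h126` — cited, displayed, NOT proved), labels `SL`/`k`,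
`μ ≠ ν`, `Nc ≠ 0`, `Odd Lc`, `2 ≤ Lc`, `2 ≤ N` ⟹ (D1).  No numeral lock and no window datum is displayed.  Discharges nothing of (D1) by itself. -/
theorem d1Drift_record_of_D1Tel_D1Rep (hLc : Odd Lc) (hL2 : 2 ≤ Lc) {N : ℕ} (hN : 2 ≤ N) (a : ℝ) (ha : 0 < a)
    (h12 : B5.Prop12Printed (fam (fun i : ℕ+ × ℕ => ((i.1 : ℕ+) : ℕ)) (fun i => i.1.pos) MvE a ha))
    (h126 : B5.Kernel126_127Printed (kfam (fun i : ℕ+ × ℕ => ((i.1 : ℕ+) : ℕ)) MvE))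
    {SL : Finset L} (hSL : SL.Nonempty) (k : L → Fin 4) {μ ν : Fin 4} (hμν : μ ≠ ν) {Nc : ℝ} (hNc : Nc ≠ 0)
    (Jc : ∀ m : ℕ, JetData 3 (Lc ^ m))
    (htel : D1Tel Lc (JsB12CombShSym hLc N (symTablesAn1S2 3 Lc (2 / (Lc : ℝ) ^ 4)) (2 / (Lc : ℝ) ^ 4) (-((Lc : ℝ) ^ 12 / 4))) Jc)
    (hrep : D1Rep Lc Jc Nc μ ν a SL k) :
    D1Drift Lc (JsB12CombShSym hLc N (symTablesAn1S2 3 Lc (2 / (Lc : ℝ) ^ 4)) (2 / (Lc : ℝ) ^ 4) (-((Lc : ℝ) ^ 12 / 4))) Nc μ ν :=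
  d1Drift_JsB12CombShSym_an1TablesS2_pinned_of_locks_D1Tel_D1Rep hLc hL2 hN (2 / (Lc : ℝ) ^ 4) (-((Lc : ℝ) ^ 12 / 4)) (lock_mul_pow hL2) rfl
    a ha h12 h126 hSL k hμν hNc Jc htel (cc := 1) (Mw' := fun n => n) le_rfl window_id window_id_le hrep

/-- [folklore] **THE SCHEME-FREE END AT THE LITERAL OF RECORD** (any table parameters `cΛ`, `cB`): (RB) onto some composite jets `Jc` ∧ (OSL) for those jets ⟹ (D1)
— NO printed input, NO window, NO label, NO lock, NO side condition on `Lc`, `N`, `μ`, `ν`. -/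
theorem d1Drift_record_of_readoutBdd_oneShotLaw (hLc : Odd Lc) (N : ℕ) (cΛ cB : ℝ) {Nc : ℝ} {μ ν : Fin 4} (Jc : ∀ m : ℕ, JetData 3 (Lc ^ m))
    (hbdd : ∃ U' : ℝ, ∀ m : ℕ, 1 ≤ m →
      |∑ j ∈ range m, secondMoment (TbalOf Lc (JsB12CombShSym hLc N (symTablesAn1S2 3 Lc cΛ) cΛ cB) j) μ ν - secondMoment (TshotOf Lc Jc m) μ ν| ≤ U')
    (hlaw : ∃ U : ℝ, ∀ m : ℕ, 1 ≤ m → |secondMoment (TshotOf Lc Jc m) μ ν - B12Normalization.stepBal Nc Lc * m| ≤ U) :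
    D1Drift Lc (JsB12CombShSym hLc N (symTablesAn1S2 3 Lc cΛ) cΛ cB) Nc μ ν :=
  d1Drift_of_readoutBdd_oneShotLaw _ Jc hbdd hlaw

/-- [folklore] **EXACTNESS AT THE LITERAL OF RECORD**: for every telescoping partner `Jc` ((RB)) of the step jets of record, (D1) ⟺ (OSL) for `Jc` — the one-shot
one-loop law is not merely sufficient but NECESSARY.  This is the exact missing lemma of row (D1). -/
theorem d1Drift_record_iff_oneShotLaw_of_readoutBdd (hLc : Odd Lc) (N : ℕ) (cΛ cB : ℝ) {Nc : ℝ} {μ ν : Fin 4} (Jc : ∀ m : ℕ, JetData 3 (Lc ^ m))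
    (hbdd : ∃ U' : ℝ, ∀ m : ℕ, 1 ≤ m →
      |∑ j ∈ range m, secondMoment (TbalOf Lc (JsB12CombShSym hLc N (symTablesAn1S2 3 Lc cΛ) cΛ cB) j) μ ν - secondMoment (TshotOf Lc Jc m) μ ν| ≤ U') :
    D1Drift Lc (JsB12CombShSym hLc N (symTablesAn1S2 3 Lc cΛ) cΛ cB) Nc μ ν ↔
      ∃ U : ℝ, ∀ m : ℕ, 1 ≤ m → |secondMoment (TshotOf Lc Jc m) μ ν - B12Normalization.stepBal Nc Lc * m| ≤ U :=
  d1Drift_iff_oneShotLaw_of_readoutBdd _ Jc hbdd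

/-- [folklore] **THE MIXED END AT THE LITERAL OF RECORD**: (RB) (the `O(1)`-tolerant telescoping) ∧ `D1Rep` (road BF-x) ∧ the two PRINTED [B5] statements BY NAME ∧ labels ∧
`μ ≠ ν`, `Nc ≠ 0`, `2 ≤ Lc` ⟹ (D1); ROOT M‴'s exact `D1Tel` weakened to the bounded read-out defect, window instantiated, no lock (any `cΛ`, `cB`), no `Odd Lc`-beyond-the-literal ∕
`2 ≤ N` (no symmetry letter of the step family is consumed on this road). -/
theorem d1Drift_record_of_readoutBdd_D1Rep (hLc : Odd Lc) (hL2 : 2 ≤ Lc) (N : ℕ) (cΛ cB : ℝ) (a : ℝ) (ha : 0 < a)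
    (h12 : B5.Prop12Printed (fam (fun i : ℕ+ × ℕ => ((i.1 : ℕ+) : ℕ)) (fun i => i.1.pos) MvE a ha))
    (h126 : B5.Kernel126_127Printed (kfam (fun i : ℕ+ × ℕ => ((i.1 : ℕ+) : ℕ)) MvE))
    {SL : Finset L} (hSL : SL.Nonempty) (k : L → Fin 4) {μ ν : Fin 4} (hμν : μ ≠ ν) {Nc : ℝ} (hNc : Nc ≠ 0)
    (Jc : ∀ m : ℕ, JetData 3 (Lc ^ m))
    (hbdd : ∃ U' : ℝ, ∀ m : ℕ, 1 ≤ m →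
      |∑ j ∈ range m, secondMoment (TbalOf Lc (JsB12CombShSym hLc N (symTablesAn1S2 3 Lc cΛ) cΛ cB) j) μ ν - secondMoment (TshotOf Lc Jc m) μ ν| ≤ U')
    (hrep : D1Rep Lc Jc Nc μ ν a SL k) :
    D1Drift Lc (JsB12CombShSym hLc N (symTablesAn1S2 3 Lc cΛ) cΛ cB) Nc μ ν :=
  d1Drift_of_readoutBdd_oneShotLaw _ Jc hbdd
    (oneShotLaw_of_d1Rep a ha h12 h126 hSL k hμν hNc hL2 (cc := 1) (M := fun n => n) le_rfl window_id window_id_le Jc hrep)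

end Summit.QuantumFields.BalabanUV.Gaps.D1BinderEnds

end
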